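import Mathlib
import HarnessLib
import Literature.MathematicalPhysics.StatisticalMechanics.RelevantHamiltonians
import Literature.MathematicalPhysics.StatisticalMechanics.GradientFieldNorms

/-!
# Line `gnv`: the `ι`-symmetric relevant Hamiltonians (real constant and quadratic, imaginary linear
# coefficients)

Crux `HypACumulant` (stmt-HubbardSuperconductivity-19154), line `gnv`.  The route's "why it might
fail" is that the fine-tuned quadratic form must stay REAL on the `ι`-symmetric class
(`ι F(φ) = conj F(−φ)`; files `…HypACumulantIota.lean`, `…InitialNorm.lean`).  The other coordinate of
the renormalisation-group flow is the relevant Hamiltonian `H ∈ M_0(𝓑_k)`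
(`Literature/…/RelevantHamiltonians.lean`, coefficients in `ℂ`): `H(B,φ) = Σ_{x∈B} [λ + Σ_α a_α ∇^αφ(x)
+ Σ_{i≤j} a_{ij} ∇_iφ(x)∇_jφ(x)]`.  Since the monomials have parities `+, −, +` under `φ ↦ −φ`
(`relMonomial_neg_field`), the functional `H(B, ·)` is `ι`-symmetric as soon as
`λ, a_{ij} ∈ ℝ` and `a_α ∈ iℝ` (`eval_neg_eq_conj`): this is the real subspace of `M_0 ⊗ ℂ` in which
the relevant coordinate of the flow lives on the `ι`-symmetric class (GNV-PLAN §1: "the extracted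
constants (energy) and quadratic forms (marginal `q`) are REAL and the linear terms `ℓ·∇φ` are
IMAGINARY, at every scale"), and conversely the projection `Π_2` of an `ι`-symmetric functional has
coefficients of exactly these types (even Taylor coefficients real, odd imaginary —
`iota_iteratedFDeriv_zero_even/odd` of `…HypACumulantIota.lean`; the `Π_2` half is not in this file).
-/

noncomputable section

-- `Summit.<Summit>.<Problem>`: single-conjunct summit, the duplicate component is mandated (D-0017).
set_option linter.dupNamespace false

namespace Summit.HubbardSuperconductivity.HubbardSuperconductivity.Theorems.ComplexGFF

open scoped ComplexConjugate
open Finset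
open Literature.MathematicalPhysics.StatisticalMechanics.GradientFRD (fwdDiff iterDiff)
open Literature.MathematicalPhysics.StatisticalMechanics.GradientRG
  (RelIndex linIndex quadIndex RelevantHamiltonian relMonomial density eval iterDiff_smul)

variable {d M : ℕ}

/-- `∇_i(−φ) = −∇_iφ`. -/
theorem fwdDiff_neg_field (i : Fin d) (φ : (Fin d → ZMod M) → ℝ) :
    fwdDiff i (-φ) = -fwdDiff i φ := by
  funext x
  simp only [Literature.MathematicalPhysics.StatisticalMechanics.GradientFRD.fwdDiff, Pi.neg_apply]
  ring

/-- `∇^α(−φ) = −∇^αφ`. -/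
theorem iterDiff_neg_field (α : Fin d → ℕ) (φ : (Fin d → ZMod M) → ℝ) :
    iterDiff α (-φ) = -iterDiff α φ := by
  have h := iterDiff_smul (M := M) α (-1) φ
  simp only [neg_smul, one_smul] at h
  exact h

/-- **Parities of the relevant monomials** under the field reflection `φ ↦ −φ`: the constant and the
quadratic monomials are even, the linear ones are odd. -/
theorem relMonomial_neg_field (ι : RelIndex d) (φ : (Fin d → ZMod M) → ℝ) (x : Fin d → ZMod M) :
    relMonomial ι (-φ) x =
      (match ι with
        | Sum.inl _ => relMonomial ι φ x
        | Sum.inr (Sum.inl _) => -relMonomial ι φ x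
        | Sum.inr (Sum.inr _) => relMonomial ι φ x) := by
  rcases ι with u | α | q
  · rfl
  · simp only [Literature.MathematicalPhysics.StatisticalMechanics.GradientRG.relMonomial_lin,
      iterDiff_neg_field, Pi.neg_apply]
  · simp only [Literature.MathematicalPhysics.StatisticalMechanics.GradientRG.relMonomial_quad,
      fwdDiff_neg_field, Pi.neg_apply, neg_mul_neg]

/-- **`ι`-symmetry of a relevant Hamiltonian with real constant and quadratic and imaginary linear
coefficients**: if `conj λ = λ`, `conj a_α = −a_α` and `conj a_{ij} = a_{ij}`, then the density
satisfies `𝓗({x}, −φ) = conj 𝓗({x}, φ)`. -/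
theorem density_neg_eq_conj {H : RelevantHamiltonian ℂ d}
    (hc : ∀ u : Unit, conj (H (Sum.inl u)) = H (Sum.inl u))
    (hl : ∀ α : linIndex d, conj (H (Sum.inr (Sum.inl α))) = -H (Sum.inr (Sum.inl α)))
    (hq : ∀ q : quadIndex d, conj (H (Sum.inr (Sum.inr q))) = H (Sum.inr (Sum.inr q)))
    (φ : (Fin d → ZMod M) → ℝ) (x : Fin d → ZMod M) :
    density H (-φ) x = conj (density H φ x) := by
  unfold density
  rw [map_sum]
  refine Finset.sum_congr rfl fun ι _ => ?_
  rw [relMonomial_neg_field]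
  rcases ι with u | α | q
  · simp only [Complex.real_smul, map_mul, Complex.conj_ofReal, hc]
  · simp only [Complex.real_smul, map_mul, Complex.conj_ofReal, hl, Complex.ofReal_neg]
    ring
  · simp only [Complex.real_smul, map_mul, Complex.conj_ofReal, hq]

/-- **`H(B, −φ) = conj H(B, φ)`** for a relevant Hamiltonian with real constant and quadratic and
imaginary linear coefficients: `H(B, ·)` lies in the `ι`-symmetric class on which the line `gnv` runs
the renormalisation group. -/
theorem eval_neg_eq_conj {H : RelevantHamiltonian ℂ d}
    (hc : ∀ u : Unit, conj (H (Sum.inl u)) = H (Sum.inl u))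
    (hl : ∀ α : linIndex d, conj (H (Sum.inr (Sum.inl α))) = -H (Sum.inr (Sum.inl α)))
    (hq : ∀ q : quadIndex d, conj (H (Sum.inr (Sum.inr q))) = H (Sum.inr (Sum.inr q)))
    (B : Finset (Fin d → ZMod M)) (φ : (Fin d → ZMod M) → ℝ) :
    eval H B (-φ) = conj (eval H B φ) := by
  unfold eval
  rw [map_sum]
  exact Finset.sum_congr rfl fun x _ => density_neg_eq_conj hc hl hq φ x

/-- The coefficientwise conditions are preserved by REAL linear combinations: the `ι`-symmetric
Hamiltonians form a real subspace of `M_0 ⊗ ℂ` (closure under `+`). -/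
theorem iotaCoeff_add {H H' : RelevantHamiltonian ℂ d}
    (hc : ∀ u : Unit, conj (H (Sum.inl u)) = H (Sum.inl u))
    (hl : ∀ α : linIndex d, conj (H (Sum.inr (Sum.inl α))) = -H (Sum.inr (Sum.inl α)))
    (hq : ∀ q : quadIndex d, conj (H (Sum.inr (Sum.inr q))) = H (Sum.inr (Sum.inr q)))
    (hc' : ∀ u : Unit, conj (H' (Sum.inl u)) = H' (Sum.inl u))
    (hl' : ∀ α : linIndex d, conj (H' (Sum.inr (Sum.inl α))) = -H' (Sum.inr (Sum.inl α)))
    (hq' : ∀ q : quadIndex d, conj (H' (Sum.inr (Sum.inr q))) = H' (Sum.inr (Sum.inr q))) :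
    (∀ u : Unit, conj ((H + H') (Sum.inl u)) = (H + H') (Sum.inl u)) ∧
    (∀ α : linIndex d, conj ((H + H') (Sum.inr (Sum.inl α))) = -(H + H') (Sum.inr (Sum.inl α))) ∧
    (∀ q : quadIndex d, conj ((H + H') (Sum.inr (Sum.inr q))) = (H + H') (Sum.inr (Sum.inr q))) := by
  refine ⟨fun u => ?_, fun α => ?_, fun q => ?_⟩
  · simp only [Pi.add_apply, map_add, hc, hc']
  · simp only [Pi.add_apply, map_add, hl, hl', neg_add]
  · simp only [Pi.add_apply, map_add, hq, hq']

/-- … and under multiplication by REAL scalars. -/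
theorem iotaCoeff_smul {H : RelevantHamiltonian ℂ d} (r : ℝ)
    (hc : ∀ u : Unit, conj (H (Sum.inl u)) = H (Sum.inl u))
    (hl : ∀ α : linIndex d, conj (H (Sum.inr (Sum.inl α))) = -H (Sum.inr (Sum.inl α)))
    (hq : ∀ q : quadIndex d, conj (H (Sum.inr (Sum.inr q))) = H (Sum.inr (Sum.inr q))) :
    (∀ u : Unit, conj (((r : ℂ) • H) (Sum.inl u)) = ((r : ℂ) • H) (Sum.inl u)) ∧
    (∀ α : linIndex d, conj (((r : ℂ) • H) (Sum.inr (Sum.inl α))) = -((r : ℂ) • H) (Sum.inr (Sum.inl α))) ∧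
    (∀ q : quadIndex d, conj (((r : ℂ) • H) (Sum.inr (Sum.inr q))) = ((r : ℂ) • H) (Sum.inr (Sum.inr q))) := by
  refine ⟨fun u => ?_, fun α => ?_, fun q => ?_⟩
  · simp only [Pi.smul_apply, smul_eq_mul, map_mul, Complex.conj_ofReal, hc]
  · simp only [Pi.smul_apply, smul_eq_mul, map_mul, Complex.conj_ofReal, hl, mul_neg]
  · simp only [Pi.smul_apply, smul_eq_mul, map_mul, Complex.conj_ofReal, hq]

end Summit.HubbardSuperconductivity.HubbardSuperconductivity.Theorems.ComplexGFF

end
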